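import Summits.QuantumFields.BalabanUV.Beta.GAN24.InsertionChainLaw
import Summits.QuantumFields.BalabanUV.T4Continuum.Support.FirstOrderBackgroundModel

/-!
# `BalabanUV.Beta.GAN24.InsertionChainLawKing` — binder row G-an2-4 ∕ (CONV-C), routes R6 × R7 in NE2's operator currency, PART 116: THE INSTANCE.
# On King's tower of Bałaban's free vector operators `Δ_a^{(k)}` (spacing `L^{−k}`, torus of `M` unit periods; `FreeTowerLaws` a THEOREM —
# `NE2PerturbedLayer.freeTowerLaws_king`) EVERY perturbation family with `PerturbationLaws … κ (C₂L^{−k})` has, for EVERY order `n`, a convergent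
# unit-lattice image of its `n`-th insertion chain `(𝒢^{(k)}P_k)^n𝒢^{(k)}` with rate `L^{−k}` and an explicit constant; with the t4-ne2-p1 lineage's
# DISCHARGED `FirstOrderBackgroundModel.perturbationLaws_firstOrder` this is UNCONDITIONAL: the `n`-th order insertion of a Lipschitz connection
# `𝒜·∇` into Bałaban's vector propagator — `n = 1`: `𝒢^{(k)}(𝒜^{(k)}·∇^{(k)})𝒢^{(k)}`, the first BACKGROUND-DERIVATIVE of the propagator — King-averaged to
# the unit lattice, CONVERGES as `k → ∞` at rate `L^{−k}` (unit b2b-balaban-gan24-p3, gen 51; v1)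

NOT IN PRINT; OUR PROOF ([folklore] composition BY NAME: PART 115 `InsertionChainLaw.oneStepAveragedLaw_insertion` ∕ `towerLimitRate_insertion` over
`NE2PerturbedLayer.freeTowerLaws_king` (t4-ne2-p1 generation 9: Bałaban's `Δ_a^{(k)}` [Balaban1984PropagatorsI] (1.69)∕(1.73), King's one-step block averaging
[King1986] (2.10) and pairing `J_k = L^{d∕2}Q_Lᴴ`, complement ∕ injected defects `2dCst·L^{−k}` ∕ `CJ·L^{−k}` — THEOREMS of `Support/KingPairingPlantedLaw`) and
`FirstOrderBackgroundModel.perturbationLaws_firstOrder` (the first-order minimal-coupling model, `PerturbationLaws` DISCHARGED from the Lipschitz data alone);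
the printed items are LOCATORS of the objects, nothing printed is a hypothesis).
HONEST FRAMING (cell contract, verbatim): «discharging `BetaPertH` makes Bałaban's UV stability UNCONDITIONAL — a real constructive-QFT result; it is NOT the
continuum limit and NOT the Clay problem.»  HONEST DEPENDENCY (verbatim): «continuum YM on T⁴ ⇐ BetaPertH ∧ nine spine estimates (0/9 proved); BetaPertH ⇐
(D1) ∧ (D4) ∧ CAP+tail; G-an2-4 gates asym, D1 and NE2/3/4.»

WHY THIS FILE.  PART 115 turned NE2's typed with-background interface into a rate engine for the u-DERIVATIVE sector: the same five letters that give the one-step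
law of the VALUES `(D_k + tP_k)⁻¹` give it, losslessly, for every Taylor coefficient `T_n = (D⁻¹P)^nD⁻¹`.  This file instantiates the engine on the one tower of
the tree where `FreeTowerLaws` is a theorem (King's averaging of Bałaban's `Δ_a`) — §1, for ANY `PerturbationLaws` family, so that every present and future
discharge of `PerturbationLaws` on this tower (today: the first-order model UNCONDITIONALLY; `PerturbationAlgebra.perturbationLaws_minimalCoupling`;
`PlantedPotentialRate`; Bałaban's shaped operator `Spine/NE2BalabanFinalRate.perturbationLaws_balaban_final_rate` CONDITIONALLY on node NE3's binder) is at once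
a rate theorem for its derivative insertions — and §2, for the first-order model, with NO typed residual: the first kernel-checked η-RATE of a
BACKGROUND-DERIVATIVE constituent in the tree (the caricature of (MF′)'s `K_u`-type rows T1 ∕ T4: `G·𝒱[h]·G` with a gradient vertex), in the currency route R7
prescribes for the rate half (operator norm on the unit torus, no decay claimed; the decay half is (H2), the join road P1's `decayCauchy_of_uniformDecays_supRate`).

WHAT THIS FILE PROVES (0 sorry, 0 `def`, nothing cited; `L ≥ 1` a block side (`NeZero`), `M : Fin d → ℕ` the unit periods, `a > 0`; `Δ_a^{(k)} = calDalev k`,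
`𝒢^{(k)} = calGlev k = (Δ_a^{(k)})⁻¹`, `Q_L = Qlev`, `J_k = JpcT`):
* §1 **`oneStepAveragedLaw_insertion_king`** ∕ **`towerLimitRate_insertion_king`** (`L ≥ 2`): `PerturbationLaws (Δ_a^{(·)}) P J κ (C₂L^{−k})` ⟹ for every `n`,
  `TowerLimitRate Q_L L^d (k ↦ (𝒢^{(k)}P_k)^n𝒢^{(k)}) ((n+1)κ^nCJ + nκ^{n−1}C₂ + κ^n·2dCst) L^{−1}` — the unit-lattice images
  `(L^d)^k·Q^{(k)}(𝒢^{(k)}P_k)^n𝒢^{(k)}Q^{(k)ᴴ}` CONVERGE with `‖c_k − c_∞‖ ≤ C_n·L^{−k}/(1 − L^{−1})`; `insertionTower_tendsto_king` unfolds it.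
* §2 **`towerLimitRate_firstOrderInsertion`** (`L ≥ 2`, `d ≥ 1`, `LipschitzBackground V α β`): the same for `P_k = Σ_μ diag(V^{(k)}_μ)∇^{(k)}_μ` with
  `κ = d(α+β)Cst`, `C₂ = C2model` — UNCONDITIONAL, every order `n`, NO smallness of the background (the insertion chains are polynomial in `P`: no Neumann
  disc); **`towerLimitRate_firstOrderInsertion_one`**: `n = 1`, the tower `k ↦ 𝒢^{(k)}·(V^{(k)}·∇^{(k)})·𝒢^{(k)}` with constant `2κ·CJ + C2model + κ·2dCst`;
  **`firstOrderInsertion_tendsto`**: the limit named with the explicit bound.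
WHAT IT DOES NOT DO: identify `V` with Bałaban's minimiser legs `h_b = 𝓗_ke_b` (R7 S1 ∕ (ρ5), typing) or treat the `O(𝒜²)`, gauge and Gram terms (their
`PerturbationLaws` are NE2's rows B3 ∕ B4 ∕ B5 — §1 applies to them BY NAME); the decay half; position-space (entry) currency beyond «unit-lattice entries ≤ operator
norm».  SUPPLIER work (junction R6 × R7 × NE2); no consumer of record; NEVER «G-an2-4 closed»; NOT (CONV-C), NOT D1, NOT `BetaPertH`, NOT continuum, NOT Clay.
Records: `HOME/b2b-balaban-gan24-p3/gen51/README.md`.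
-/

noncomputable section

open scoped BigOperators ComplexConjugate Matrix Matrix.Norms.L2Operator
open Filter Topology

namespace Summit.QuantumFields.BalabanUV.Beta.GAN24.InsertionChainLawKing

open Literature.MathematicalPhysics.QuantumFieldTheory.Balaban1983to89.B5Prop11Plancherel (Cst Cst_nonneg)
open Summit.QuantumFields.BalabanUV.T4Continuum
open Summit.QuantumFields.BalabanUV.T4Continuum.CovariantAveragingTower (avgTow OneStepAveragedLaw TowerLimitRate towerLimitRate_of_oneStepAveragedLaw)
open Summit.QuantumFields.BalabanUV.T4Continuum.BalabanAveragedTowerUnit (idx Qlev calGlev opNorm_Qlev_sq_le)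
open Summit.QuantumFields.BalabanUV.T4Continuum.BackgroundResolventTower (PerturbationLaws)
open Summit.QuantumFields.BalabanUV.T4Continuum.KingPairingPlantedLaw (JpcT calDalev calDalev_inv CJ CJ_nonneg)
open Summit.QuantumFields.BalabanUV.T4Continuum.NE2PerturbedLayer (freeTowerLaws_king)
open Summit.QuantumFields.BalabanUV.T4Continuum.FirstOrderBackgroundModel (LipschitzBackground Pmodel C2model perturbationLaws_firstOrder)
open Summit.QuantumFields.BalabanUV.Beta.GAN24.InsertionChainLaw (oneStepAveragedLaw_insertion towerLimitRate_insertion)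

variable {d : ℕ} (L : ℕ) [NeZero L] (M : Fin d → ℕ) [hM : ∀ μ, NeZero (M μ)] (a : ℝ) (ha : 0 < a)

/-! ## §1 King's tower: every `PerturbationLaws` family, every insertion order -/

/-- **`oneStepAveragedLaw_insertion_king`** [our proof]: on King's tower (`FreeTowerLaws` a theorem, pairing defect `f = 0`), every perturbation family with
`PerturbationLaws (Δ_a^{(·)}) P J κ e₂` has, for every order `n`, the one-step averaged law of its `n`-th insertion chain with error
`((n+1)κ^n·CJ·L^{−k} + nκ^{n−1}·e₂ k) + κ^n·2dCst·L^{−k}`. -/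
theorem oneStepAveragedLaw_insertion_king {P : (k : ℕ) → Matrix (idx L M k) (idx L M k) ℂ} {κ : ℝ} {e₂ : ℕ → ℝ}
    (hpert : PerturbationLaws (calDalev L M a ha) P (JpcT L M) κ e₂) (n : ℕ) :
    OneStepAveragedLaw (Qlev L M) ((L : ℝ) ^ d) (fun k => ((calDalev L M a ha k)⁻¹ * P k) ^ n * (calDalev L M a ha k)⁻¹)
      (fun k => ((n + 1) * κ ^ n * (CJ d a * ((L : ℝ)⁻¹) ^ k) + n * κ ^ (n - 1) * e₂ k) + κ ^ n * (2 * d * Cst d a * ((L : ℝ)⁻¹) ^ k)) := by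
  have hr : (0 : ℝ) < (L : ℝ) ^ d := pow_pos (by exact_mod_cast Nat.pos_of_ne_zero (NeZero.ne L)) d
  intro k
  refine (oneStepAveragedLaw_insertion hr (freeTowerLaws_king L M a ha) hpert n k).trans (le_of_eq ?_)
  simp only [mul_zero, add_zero]

/-- **`towerLimitRate_insertion_king` — THE TOWER LIMIT WITH RATE OF EVERY INSERTION ORDER ON KING's TOWER** [our proof] (`L ≥ 2`): for every perturbation family
with (H-bd) `‖P_k𝒢^{(k)}‖, ‖𝒢^{(k)}P_k‖ ≤ κ` and (H-cons) `‖𝒢^{(k+1)}(P_{k+1}J_k − J_kP_k)𝒢^{(k)}‖ ≤ C₂L^{−k}`, and every order `n`, the King-averaged unit-lattice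
images `(L^d)^k·Q^{(k)}(𝒢^{(k)}P_k)^n𝒢^{(k)}Q^{(k)ᴴ}` CONVERGE with `‖c_k − c_∞‖ ≤ C_n·L^{−k}/(1 − L^{−1})`, `C_n = (n+1)κ^nCJ + nκ^{n−1}C₂ + κ^n·2dCst`.  NO coupling,
NO smallness: the insertion chains are polynomial in the perturbation. -/
theorem towerLimitRate_insertion_king (hL : 2 ≤ L) {P : (k : ℕ) → Matrix (idx L M k) (idx L M k) ℂ} {κ C₂ : ℝ}
    (hpert : PerturbationLaws (calDalev L M a ha) P (JpcT L M) κ (fun k => C₂ * ((L : ℝ)⁻¹) ^ k)) (n : ℕ) :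
    TowerLimitRate (Qlev L M) ((L : ℝ) ^ d) (fun k => ((calDalev L M a ha k)⁻¹ * P k) ^ n * (calDalev L M a ha k)⁻¹)
      (((n + 1) * κ ^ n * CJ d a + n * κ ^ (n - 1) * C₂) + κ ^ n * (2 * d * Cst d a)) ((L : ℝ)⁻¹) := by
  have hL1 : (1 : ℝ) < L := by exact_mod_cast (lt_of_lt_of_le one_lt_two hL : 1 < L)
  have hr : (0 : ℝ) < (L : ℝ) ^ d := pow_pos (lt_trans zero_lt_one hL1) d
  have hlaw : OneStepAveragedLaw (Qlev L M) ((L : ℝ) ^ d) (fun k => ((calDalev L M a ha k)⁻¹ * P k) ^ n * (calDalev L M a ha k)⁻¹)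
      (fun k => ((((n : ℝ) + 1) * κ ^ n * CJ d a + n * κ ^ (n - 1) * C₂) + κ ^ n * (2 * d * Cst d a)) * ((L : ℝ)⁻¹) ^ k) := by
    intro k
    refine (oneStepAveragedLaw_insertion_king L M a ha hpert n k).trans (le_of_eq ?_)
    ring
  exact towerLimitRate_of_oneStepAveragedLaw (Qlev L M) hr (opNorm_Qlev_sq_le L M) _ (inv_lt_one_of_one_lt₀ hL1) hlaw

/-- the same, unfolded: existence of the limit of the unit-lattice images and the explicit rate. [our proof] -/
theorem insertionTower_tendsto_king (hL : 2 ≤ L) {P : (k : ℕ) → Matrix (idx L M k) (idx L M k) ℂ} {κ C₂ : ℝ}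
    (hpert : PerturbationLaws (calDalev L M a ha) P (JpcT L M) κ (fun k => C₂ * ((L : ℝ)⁻¹) ^ k)) (n : ℕ) :
    ∃ cinf : Matrix (idx L M 0) (idx L M 0) ℂ,
      Tendsto (avgTow (Qlev L M) ((L : ℝ) ^ d) (fun k => ((calDalev L M a ha k)⁻¹ * P k) ^ n * (calDalev L M a ha k)⁻¹)) atTop (𝓝 cinf) ∧
      ∀ k, ‖avgTow (Qlev L M) ((L : ℝ) ^ d) (fun k => ((calDalev L M a ha k)⁻¹ * P k) ^ n * (calDalev L M a ha k)⁻¹) k - cinf‖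
        ≤ (((n + 1) * κ ^ n * CJ d a + n * κ ^ (n - 1) * C₂) + κ ^ n * (2 * d * Cst d a)) * ((L : ℝ)⁻¹) ^ k / (1 - (L : ℝ)⁻¹) :=
  towerLimitRate_insertion_king L M a ha hL hpert n

/-! ## §2 The first-order model: the η-rate of the background-DERIVATIVE insertions, unconditionally -/

/-- **`towerLimitRate_firstOrderInsertion` — THE η-RATE OF EVERY BACKGROUND INSERTION OF A LIPSCHITZ CONNECTION, UNCONDITIONALLY** [our proof] (`L ≥ 2`, `d ≥ 1`):
for coefficient fields `V` with `LipschitzBackground V α β` (size `α`, Lipschitz ∕ two-spacing consistency `β` — e.g. the samples of ONE Lipschitz connection at every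
spacing) and `P_k = Σ_μ diag(V^{(k)}_μ)·∇^{(k)}_μ`, for every order `n` the King-averaged unit-lattice images of `(𝒢^{(k)}P_k)^n𝒢^{(k)}` CONVERGE at rate `L^{−k}` with
the constant of §1 at `κ = d(α+β)Cst`, `C₂ = C2model d L a α β`.  NO typed residual, NO smallness of `(α, β)`. -/
theorem towerLimitRate_firstOrderInsertion (hL : 2 ≤ L) (hd : 1 ≤ d) {V : (k : ℕ) → Fin d → (idx L M k → ℂ)} {α β : ℝ}
    (hV : LipschitzBackground L M V α β) (n : ℕ) :
    TowerLimitRate (Qlev L M) ((L : ℝ) ^ d) (fun k => ((calDalev L M a ha k)⁻¹ * Pmodel L M V k) ^ n * (calDalev L M a ha k)⁻¹)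
      (((n + 1) * (d * (α + β) * Cst d a) ^ n * CJ d a + n * (d * (α + β) * Cst d a) ^ (n - 1) * C2model d L a α β)
        + (d * (α + β) * Cst d a) ^ n * (2 * d * Cst d a)) ((L : ℝ)⁻¹) :=
  towerLimitRate_insertion_king L M a ha hL (perturbationLaws_firstOrder L M a ha hd hV) n

/-- **`towerLimitRate_firstOrderInsertion_one` — THE FIRST BACKGROUND-DERIVATIVE OF THE PROPAGATOR** [our proof]: the tower
`k ↦ 𝒢^{(k)}·(Σ_μ diag(V^{(k)}_μ)∇^{(k)}_μ)·𝒢^{(k)}` (`= −∂_t|_{t=0}(Δ_a^{(k)} + tP_k)⁻¹`, PART 115 §5), King-averaged to the unit lattice, CONVERGES at rate `L^{−k}` with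
constant `2κ·CJ + C2model + κ·2dCst`, `κ = d(α+β)Cst` — the caricature of (MF′)'s first-order u-derivative rows (a gradient vertex between two propagators) in R7's
rate currency. -/
theorem towerLimitRate_firstOrderInsertion_one (hL : 2 ≤ L) (hd : 1 ≤ d) {V : (k : ℕ) → Fin d → (idx L M k → ℂ)} {α β : ℝ}
    (hV : LipschitzBackground L M V α β) :
    TowerLimitRate (Qlev L M) ((L : ℝ) ^ d) (fun k => calGlev L M a ha k * Pmodel L M V k * calGlev L M a ha k)
      ((2 * (d * (α + β) * Cst d a) * CJ d a + C2model d L a α β) + (d * (α + β) * Cst d a) * (2 * d * Cst d a)) ((L : ℝ)⁻¹) := by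
  have h := towerLimitRate_firstOrderInsertion L M a ha hL hd hV 1
  have e : (fun k => ((calDalev L M a ha k)⁻¹ * Pmodel L M V k) ^ 1 * (calDalev L M a ha k)⁻¹)
      = fun k => calGlev L M a ha k * Pmodel L M V k * calGlev L M a ha k := by
    funext k
    rw [pow_one, calDalev_inv]
  rw [e] at h
  have hc : (2 * (d * (α + β) * Cst d a) * CJ d a + C2model d L a α β) + (d * (α + β) * Cst d a) * (2 * d * Cst d a)
      = (((1 : ℕ) : ℝ) + 1) * (d * (α + β) * Cst d a) ^ 1 * CJ d a + ((1 : ℕ) : ℝ) * (d * (α + β) * Cst d a) ^ (1 - 1) * C2model d L a α β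
        + (d * (α + β) * Cst d a) ^ 1 * (2 * d * Cst d a) := by
    rw [Nat.sub_self, pow_zero, pow_one, Nat.cast_one]
    ring
  rw [hc]
  exact h

/-- **`firstOrderInsertion_tendsto`** — the same with the limit named: `c¹_k := (L^d)^k·Q^{(k)}·𝒢^{(k)}(V^{(k)}·∇^{(k)})𝒢^{(k)}·Q^{(k)ᴴ} → c¹_∞` and
`‖c¹_k − c¹_∞‖ ≤ (2κ·CJ + C2model + κ·2dCst)·L^{−k}/(1 − L^{−1})` for every `k`. [our proof] -/
theorem firstOrderInsertion_tendsto (hL : 2 ≤ L) (hd : 1 ≤ d) {V : (k : ℕ) → Fin d → (idx L M k → ℂ)} {α β : ℝ}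
    (hV : LipschitzBackground L M V α β) :
    ∃ cinf : Matrix (idx L M 0) (idx L M 0) ℂ,
      Tendsto (avgTow (Qlev L M) ((L : ℝ) ^ d) (fun k => calGlev L M a ha k * Pmodel L M V k * calGlev L M a ha k)) atTop (𝓝 cinf) ∧
      ∀ k, ‖avgTow (Qlev L M) ((L : ℝ) ^ d) (fun k => calGlev L M a ha k * Pmodel L M V k * calGlev L M a ha k) k - cinf‖
        ≤ ((2 * (d * (α + β) * Cst d a) * CJ d a + C2model d L a α β) + (d * (α + β) * Cst d a) * (2 * d * Cst d a))
            * ((L : ℝ)⁻¹) ^ k / (1 - (L : ℝ)⁻¹) :=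
  towerLimitRate_firstOrderInsertion_one L M a ha hL hd hV

end Summit.QuantumFields.BalabanUV.Beta.GAN24.InsertionChainLawKing

end
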